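import Summits.RiemannHypothesis.RiemannHypothesis.Theses.NymanBeurling
import Summits.RiemannHypothesis.RiemannHypothesis.Theorems.NymanBeurlingNbThesis

/-!
# RiemannHypothesis / NymanBeurling — the support item `NbConverse` (RH ⇒ thesis)

Route `RiemannHypothesis/NymanBeurling`, item stmt-RiemannHypothesis-0396 (`NbConverse`, support,
rank 4):

  `Summit.RiemannHypothesis → ∀ ε > 0, ∃ N a, ∫⁻ |1 - ζ(1/2+it) Σ_{k<N} a_k (k+1)^{-(1/2+it)}|² dt/(1/4+t²) < ε`,

the deep half of the Nyman–Beurling–Báez-Duarte criterion in its Dirichlet-polynomial (`d_N`)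
form: under the Riemann Hypothesis the Báez-Duarte distances tend to `0`.

The conclusion of `NbConverse` is, verbatim, the route's thesis `NbThesis`, and
`Summit.RiemannHypothesis → NbThesis` is the accepted theorem
`Summit.RiemannHypothesis.RiemannHypothesis.Theorems.nbConverse_holds'`
(file `Theorems/NymanBeurlingNbThesis.lean`), the `mpr` direction of the kernel-checked
calibration `nbThesis_iff : NbThesis ↔ Summit.RiemannHypothesis`, whose deep half is
`Literature.NumberTheory.LFunctions.baezDuarte_dirichlet_onlyIf_holds` — proved in the tree on the
critical line following Báez-Duarte §2.2: `A(s) = M_n(s+δ)` with the Riesz means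
`M_n(w) = Σ_{a≤n} μ(a)(1-a/n)² a^{-w}` of `1/ζ`, the split
`1 - ζ(s)M_n(s+δ) = [1 - ζ(s)/ζ(s+δ)] + ζ(s)[1/ζ(s+δ) - M_n(s+δ)]`, Littlewood's conditional bounds
for `ζ(s)/ζ(s+δ)` and `1/ζ(s+δ)` under RH, Perron's formula for the second bracket, and dominated
convergence as `δ → 0⁺` for the first. So the item closes by that theorem; this file states it
with the literal route type.

References: L. Báez-Duarte, Rend. Lincei (9) 14 (2003) 5–11, Thm. 1.1 (only-if part), §2.2;
A. Beurling, Proc. Nat. Acad. Sci. 41 (1955) 312–314; M. Balazard, E. Saias, Adv. Math. 139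
(1998), Lemme 2.
-/

namespace Summit.RiemannHypothesis.RiemannHypothesis.Theorems

open Summit.RiemannHypothesis.RiemannHypothesis.Theses.NymanBeurling

/-- **Deep half of the Nyman–Beurling–Báez-Duarte criterion** (support item
stmt-RiemannHypothesis-0396, `NbConverse`): under the Riemann Hypothesis, for every `ε > 0` some
Dirichlet polynomial `A_N(s) = Σ_{k<N} a_k (k+1)^{-s}` achieves
`∫⁻ |1 - ζ(1/2+it) A_N(1/2+it)|² dt/(1/4+t²) < ε`. The conclusion is literally the route thesis
`NbThesis`, so this is `nbConverse_holds' : Summit.RiemannHypothesis → NbThesis`.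
[BaezDuarte2003, Thm. 1.1 (only-if part)] -/
theorem nbConverse_proof : NbConverse := by
  unfold NbConverse
  exact nbConverse_holds'

end Summit.RiemannHypothesis.RiemannHypothesis.Theorems
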